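import Mathlib
import Summits.NavierStokesRegularity.NavierStokesRegularity.Theorems.FilamentSkeletonRssSkeletonJ1RLiaLorentzSecondDerivPath
import Summits.NavierStokesRegularity.NavierStokesRegularity.Theorems.FilamentSkeletonRssSkeletonJ1RLiaReference

/-!
# Crux `SkeletonJ1R` (stmt-NavierStokesRegularity-23610) · line `streamline_kantorovich_R` · toward stub F2-d (`LiaDefectDerivBL`, v7), brick of S4′ for B1′:
# THE AMBIENT FIELD ALONG A `C²` PATH — closed form of `DW·y′`, its path-derivative, and the bound `Σ|c_k|(28/d³ + 6κ/d²) + (½+|α|)κ`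

Hand `leafhand-ns-filamentskeletonrs-1` (gen 0), `--supports stmt-NavierStokesRegularity-23610 --as helper`.  MODEL rung, NEGATIVE side of the ladder:
calculus for a HYPOTHETICAL filament-type blow-up skeleton; nothing here is a claim about Navier–Stokes regularity; the stub and the crux stay OPEN.

`W_j = ambientField` is, in closed form, `Σ_{k≠j} c_k S_k + (½y − αe₃×y)` with Lorentzian strands `S_k` (`…LiaReference.ambientField_eq`).  Along a path `y`:
* `fderiv_ambientField_apply_eq_pathDeriv` — `DW_j(yτ)·y′ = Σ_{k≠j} c_k S_k′(τ) + (½y′ − αe₃×y′)` (chain rule vs. the explicit derivative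
  `…LiaDefectDerivStrands.hasDerivAt_lorentzStrand_comp`, uniqueness);
* `hasDerivAt_ambientPathDeriv` — the closed form `p ↦ Σ c_k S_k′(p) + (½y′p − αe₃×y′p)` (`y′ = deriv y`) has derivative
  `Σ c_k S_k″ + (½y″ − αe₃×y″)` (`…LiaLorentzSecondDerivPath.hasDerivAt_lorentzStrandDeriv_comp`);
* `norm_ambientPathSecondDeriv_le` — `‖Σ c_k S_k″ + (½y″ − αe₃×y″)‖ ≤ Σ|c_k|(28/d³ + 6κ/d²) + (½+|α|)κ` when every partner line is at perpendicular
  distance `≥ d` from `yτ`, `‖y′τ‖ ≤ 1`, `‖y″‖ ≤ κ` (`…LiaLorentzSecondDeriv.norm_lorentzStrand_deriv_two_le`).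
By the mean-value inequality these give the Lipschitz constant `L₂` of `p ↦ DW_j(x p)·x′p` on the window — the `D²W` part of `H′` in S4′b.
-/

set_option linter.dupNamespace false -- `NavierStokesRegularity.NavierStokesRegularity` path/namespace repetition is the tree convention

noncomputable section

namespace Summit.NavierStokesRegularity.NavierStokesRegularity.Theorems.SkeletonJ1RFrame

open Set Function Filter MeasureTheory Real Topology
open Literature.Analysis.FluidPDE
open Summit.NavierStokesRegularity.NavierStokesRegularity.Theorems.SelectionBoxRJRung (norm_drift_le)
open scoped InnerProductSpace BigOperators

variable {N : ℕ}

/-- **`DW_j(yτ)·y′` in closed form along a path.** [folklore] -/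
theorem fderiv_ambientField_apply_eq_pathDeriv (Γ : ℝ) (p t : Fin N → EuclideanSpace ℝ (Fin 3)) (γ : Fin N → ℝ) (α : ℝ) (s₀ : Fin N → ℝ)
    (ht : ∀ k, ‖t k‖ = 1) (j : Fin N) {y : ℝ → EuclideanSpace ℝ (Fin 3)} {y' : EuclideanSpace ℝ (Fin 3)} {τ : ℝ} (hy : HasDerivAt y y' τ) :
    fderiv ℝ (ambientField Γ p t γ α s₀ j) (y τ) y' =
      (∑ k ∈ Finset.univ.erase j, (Γ * γ k / (4 * Real.pi)) •
        ((-(2 * (2 * ⟪y τ - waistPt Γ p t s₀ k, y'⟫_ℝ - 2 * ⟪y τ - waistPt Γ p t s₀ k, t k⟫_ℝ * ⟪y', t k⟫_ℝ)) /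
              (‖y τ - waistPt Γ p t s₀ k‖ ^ 2 - ⟪y τ - waistPt Γ p t s₀ k, t k⟫_ℝ ^ 2 +
                Real.exp (-(1+Real.eulerMascheroniConstant-Real.log 2)) * (1:ℝ)) ^ 2) • cross (t k) (y τ - waistPt Γ p t s₀ k) +
          (2 / (‖y τ - waistPt Γ p t s₀ k‖ ^ 2 - ⟪y τ - waistPt Γ p t s₀ k, t k⟫_ℝ ^ 2 +
              Real.exp (-(1+Real.eulerMascheroniConstant-Real.log 2)) * (1:ℝ))) • cross (t k) y')) +
        ((1/2:ℝ) • y' - α • cross (EuclideanSpace.single 2 1) y') := by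
  set W := ambientField Γ p t γ α s₀ j with hW
  have hWd : Differentiable ℝ W := (contDiff_ambientField Γ p t γ α s₀ ht j (n := 1)).differentiable one_ne_zero
  -- chain rule
  have h1 : HasDerivAt (fun τ' => W (y τ')) (fderiv ℝ W (y τ) y') τ := (hWd (y τ)).hasFDerivAt.comp_hasDerivAt τ hy
  -- explicit derivative of the closed form
  have hfun : (fun τ' => W (y τ')) = fun τ' =>
      (∑ k ∈ Finset.univ.erase j, (Γ*γ k/(4*Real.pi)) •
        ((2 / (‖y τ' - waistPt Γ p t s₀ k‖ ^ 2 - (inner ℝ (y τ' - waistPt Γ p t s₀ k) (t k)) ^ 2 +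
          Real.exp (-(1+Real.eulerMascheroniConstant-Real.log 2)) * (1:ℝ))) • cross (t k) (y τ' - waistPt Γ p t s₀ k))) +
      ((1/2:ℝ) • y τ' - α • cross (EuclideanSpace.single 2 1) (y τ')) := by
    funext τ'; rw [hW, ambientField_eq Γ p t γ α s₀ ht j (y τ'), add_sub_assoc]
  have hS : ∀ k, HasDerivAt (fun τ' => (2 / (‖y τ' - waistPt Γ p t s₀ k‖ ^ 2 - ⟪y τ' - waistPt Γ p t s₀ k, t k⟫_ℝ ^ 2 +
          Real.exp (-(1+Real.eulerMascheroniConstant-Real.log 2)) * (1:ℝ))) • cross (t k) (y τ' - waistPt Γ p t s₀ k))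
      ((-(2 * (2 * ⟪y τ - waistPt Γ p t s₀ k, y'⟫_ℝ - 2 * ⟪y τ - waistPt Γ p t s₀ k, t k⟫_ℝ * ⟪y', t k⟫_ℝ)) /
            (‖y τ - waistPt Γ p t s₀ k‖ ^ 2 - ⟪y τ - waistPt Γ p t s₀ k, t k⟫_ℝ ^ 2 +
              Real.exp (-(1+Real.eulerMascheroniConstant-Real.log 2)) * (1:ℝ)) ^ 2) • cross (t k) (y τ - waistPt Γ p t s₀ k) +
        (2 / (‖y τ - waistPt Γ p t s₀ k‖ ^ 2 - ⟪y τ - waistPt Γ p t s₀ k, t k⟫_ℝ ^ 2 +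
            Real.exp (-(1+Real.eulerMascheroniConstant-Real.log 2)) * (1:ℝ))) • cross (t k) y') τ := fun k =>
    hasDerivAt_lorentzStrand_comp coreConst_pos (waistPt Γ p t s₀ k) (t k) (ht k) hy
  have hframe : HasDerivAt (fun τ' => (1/2:ℝ) • y τ' - α • cross (EuclideanSpace.single 2 1) (y τ'))
      ((1/2:ℝ) • y' - α • cross (EuclideanSpace.single 2 1) y') τ := by
    have hc : HasDerivAt (fun τ' => cross (EuclideanSpace.single 2 1) (y τ')) (cross (EuclideanSpace.single 2 1) y') τ :=
      (crossCLM (EuclideanSpace.single 2 1)).hasFDerivAt.comp_hasDerivAt τ hy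
    exact (hy.const_smul (1/2:ℝ)).sub (hc.const_smul α)
  have hsum := HasDerivAt.fun_sum (u := Finset.univ.erase j) fun k _ => (hS k).const_smul (Γ * γ k / (4 * Real.pi))
  have h2 := hsum.add hframe
  rw [hfun] at h1
  exact h1.unique h2

/-- **The path-derivative of the closed form `Σ c_k S_k′ + (½y′ − αe₃×y′)`** (`y′ = deriv y`, `HasDerivAt (deriv y) y″ τ`). [folklore] -/
theorem hasDerivAt_ambientPathDeriv (Γ : ℝ) (p t : Fin N → EuclideanSpace ℝ (Fin 3)) (γ : Fin N → ℝ) (α : ℝ) (s₀ : Fin N → ℝ)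
    (ht : ∀ k, ‖t k‖ = 1) (j : Fin N) {y : ℝ → EuclideanSpace ℝ (Fin 3)} {y'' : EuclideanSpace ℝ (Fin 3)} {τ : ℝ}
    (hy : HasDerivAt y (deriv y τ) τ) (hy2 : HasDerivAt (deriv y) y'' τ) :
    HasDerivAt (fun q => (∑ k ∈ Finset.univ.erase j, (Γ * γ k / (4 * Real.pi)) •
        ((-(2 * (2 * ⟪y q - waistPt Γ p t s₀ k, deriv y q⟫_ℝ - 2 * ⟪y q - waistPt Γ p t s₀ k, t k⟫_ℝ * ⟪deriv y q, t k⟫_ℝ)) /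
              (‖y q - waistPt Γ p t s₀ k‖ ^ 2 - ⟪y q - waistPt Γ p t s₀ k, t k⟫_ℝ ^ 2 +
                Real.exp (-(1+Real.eulerMascheroniConstant-Real.log 2)) * (1:ℝ)) ^ 2) • cross (t k) (y q - waistPt Γ p t s₀ k) +
          (2 / (‖y q - waistPt Γ p t s₀ k‖ ^ 2 - ⟪y q - waistPt Γ p t s₀ k, t k⟫_ℝ ^ 2 +
              Real.exp (-(1+Real.eulerMascheroniConstant-Real.log 2)) * (1:ℝ))) • cross (t k) (deriv y q))) +
        ((1/2:ℝ) • deriv y q - α • cross (EuclideanSpace.single 2 1) (deriv y q)))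
      ((∑ k ∈ Finset.univ.erase j, (Γ * γ k / (4 * Real.pi)) •
        ((-(2 * (2 * ⟪deriv y τ, deriv y τ⟫_ℝ + 2 * ⟪y τ - waistPt Γ p t s₀ k, y''⟫_ℝ - 2 * ⟪deriv y τ, t k⟫_ℝ ^ 2 -
                2 * ⟪y τ - waistPt Γ p t s₀ k, t k⟫_ℝ * ⟪y'', t k⟫_ℝ)) /
              (‖y τ - waistPt Γ p t s₀ k‖ ^ 2 - ⟪y τ - waistPt Γ p t s₀ k, t k⟫_ℝ ^ 2 +
                Real.exp (-(1+Real.eulerMascheroniConstant-Real.log 2)) * (1:ℝ)) ^ 2 +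
            4 * (2 * ⟪y τ - waistPt Γ p t s₀ k, deriv y τ⟫_ℝ - 2 * ⟪y τ - waistPt Γ p t s₀ k, t k⟫_ℝ * ⟪deriv y τ, t k⟫_ℝ) ^ 2 /
              (‖y τ - waistPt Γ p t s₀ k‖ ^ 2 - ⟪y τ - waistPt Γ p t s₀ k, t k⟫_ℝ ^ 2 +
                Real.exp (-(1+Real.eulerMascheroniConstant-Real.log 2)) * (1:ℝ)) ^ 3) • cross (t k) (y τ - waistPt Γ p t s₀ k) -
          (4 * (2 * ⟪y τ - waistPt Γ p t s₀ k, deriv y τ⟫_ℝ - 2 * ⟪y τ - waistPt Γ p t s₀ k, t k⟫_ℝ * ⟪deriv y τ, t k⟫_ℝ) /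
              (‖y τ - waistPt Γ p t s₀ k‖ ^ 2 - ⟪y τ - waistPt Γ p t s₀ k, t k⟫_ℝ ^ 2 +
                Real.exp (-(1+Real.eulerMascheroniConstant-Real.log 2)) * (1:ℝ)) ^ 2) • cross (t k) (deriv y τ) +
          (2 / (‖y τ - waistPt Γ p t s₀ k‖ ^ 2 - ⟪y τ - waistPt Γ p t s₀ k, t k⟫_ℝ ^ 2 +
              Real.exp (-(1+Real.eulerMascheroniConstant-Real.log 2)) * (1:ℝ))) • cross (t k) y'')) +
        ((1/2:ℝ) • y'' - α • cross (EuclideanSpace.single 2 1) y'')) τ := by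
  have hS := fun k => hasDerivAt_lorentzStrandDeriv_comp coreConst_pos (waistPt Γ p t s₀ k) (t k) (ht k) hy hy2
  have hframe : HasDerivAt (fun q => (1/2:ℝ) • deriv y q - α • cross (EuclideanSpace.single 2 1) (deriv y q))
      ((1/2:ℝ) • y'' - α • cross (EuclideanSpace.single 2 1) y'') τ := by
    have hc : HasDerivAt (fun q => cross (EuclideanSpace.single 2 1) (deriv y q)) (cross (EuclideanSpace.single 2 1) y'') τ :=
      (crossCLM (EuclideanSpace.single 2 1)).hasFDerivAt.comp_hasDerivAt τ hy2
    exact (hy2.const_smul (1/2:ℝ)).sub (hc.const_smul α)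
  have hsum := HasDerivAt.fun_sum (u := Finset.univ.erase j) fun k _ => (hS k).const_smul (Γ * γ k / (4 * Real.pi))
  exact hsum.add hframe

/-- **Bound of the path second derivative of the ambient field**: `≤ Σ|c_k|(28/d³ + 6κ/d²) + (½+|α|)κ`. [folklore] -/
theorem norm_ambientPathSecondDeriv_le (Γ : ℝ) (p t : Fin N → EuclideanSpace ℝ (Fin 3)) (γ : Fin N → ℝ) (α : ℝ) (s₀ : Fin N → ℝ)
    (ht : ∀ k, ‖t k‖ = 1) (j : Fin N) {d κ : ℝ} (hd : 0 < d) {v y' y'' : EuclideanSpace ℝ (Fin 3)} (hy' : ‖y'‖ ≤ 1) (hy'' : ‖y''‖ ≤ κ)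
    (hfar : ∀ k, k ≠ j → d ^ 2 ≤ ‖v - waistPt Γ p t s₀ k‖ ^ 2 - (inner ℝ (v - waistPt Γ p t s₀ k) (t k)) ^ 2) :
    ‖(∑ k ∈ Finset.univ.erase j, (Γ * γ k / (4 * Real.pi)) •
        ((-(2 * (2 * ⟪y', y'⟫_ℝ + 2 * ⟪v - waistPt Γ p t s₀ k, y''⟫_ℝ - 2 * ⟪y', t k⟫_ℝ ^ 2 -
                2 * ⟪v - waistPt Γ p t s₀ k, t k⟫_ℝ * ⟪y'', t k⟫_ℝ)) /
              (‖v - waistPt Γ p t s₀ k‖ ^ 2 - ⟪v - waistPt Γ p t s₀ k, t k⟫_ℝ ^ 2 +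
                Real.exp (-(1+Real.eulerMascheroniConstant-Real.log 2)) * (1:ℝ)) ^ 2 +
            4 * (2 * ⟪v - waistPt Γ p t s₀ k, y'⟫_ℝ - 2 * ⟪v - waistPt Γ p t s₀ k, t k⟫_ℝ * ⟪y', t k⟫_ℝ) ^ 2 /
              (‖v - waistPt Γ p t s₀ k‖ ^ 2 - ⟪v - waistPt Γ p t s₀ k, t k⟫_ℝ ^ 2 +
                Real.exp (-(1+Real.eulerMascheroniConstant-Real.log 2)) * (1:ℝ)) ^ 3) • cross (t k) (v - waistPt Γ p t s₀ k) -
          (4 * (2 * ⟪v - waistPt Γ p t s₀ k, y'⟫_ℝ - 2 * ⟪v - waistPt Γ p t s₀ k, t k⟫_ℝ * ⟪y', t k⟫_ℝ) /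
              (‖v - waistPt Γ p t s₀ k‖ ^ 2 - ⟪v - waistPt Γ p t s₀ k, t k⟫_ℝ ^ 2 +
                Real.exp (-(1+Real.eulerMascheroniConstant-Real.log 2)) * (1:ℝ)) ^ 2) • cross (t k) y' +
          (2 / (‖v - waistPt Γ p t s₀ k‖ ^ 2 - ⟪v - waistPt Γ p t s₀ k, t k⟫_ℝ ^ 2 +
              Real.exp (-(1+Real.eulerMascheroniConstant-Real.log 2)) * (1:ℝ))) • cross (t k) y'')) +
        ((1/2:ℝ) • y'' - α • cross (EuclideanSpace.single 2 1) y'')‖ ≤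
      (∑ k ∈ Finset.univ.erase j, |Γ * γ k / (4 * Real.pi)| * (28 / d ^ 3 + 6 * κ / d ^ 2)) + (1/2 + |α|) * κ := by
  have hκ0 : 0 ≤ κ := (norm_nonneg _).trans hy''
  refine (norm_add_le _ _).trans (add_le_add ?_ ?_)
  · refine (norm_sum_le _ _).trans (Finset.sum_le_sum fun k hk => ?_)
    rw [norm_smul, Real.norm_eq_abs]
    refine mul_le_mul_of_nonneg_left ?_ (abs_nonneg _)
    exact norm_lorentzStrand_deriv_two_le coreConst_pos.le hd (t k) (v - waistPt Γ p t s₀ k) y' y'' (ht k) hy' hy''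
      ((hfar k (Finset.ne_of_mem_erase hk)).trans (le_add_of_nonneg_right coreConst_pos.le))
  · exact (norm_drift_le α y'').trans (mul_le_mul_of_nonneg_left hy'' (by positivity))

end Summit.NavierStokesRegularity.NavierStokesRegularity.Theorems.SkeletonJ1RFrame

end
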